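import Summits.CriticalPhenomena.PercolationContinuityZ3.Theorems.PercNearOneGluingNoHeavyLowerTailThreePointProductFormBoxSeven
import Summits.CriticalPhenomena.PercolationContinuityZ3.Theorems.PercNearOneGluingNoHeavyLowerTailThreePointProductFormBoxDisc

/-!
# The box theorem for ALL lengths follows from two bilinear PAIR LAWS on states of depth ≥ 4 (the cut reduction)
# (Sahi programme, box problem, prover prim-sahi-p2 gen 72)

Support file (`--supports stmt-CriticalPhenomena-4575`).  Standard axioms, no sorries, no named facts, no new definitions.  Memo
`run/shared/lean/prim/prim-sahi/FROM-prim-sahi-p2-gen72-MODE-FAMILIES.md` §0(3), `prim-sahi-p2/PROOF-E3.md` §82.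

THE STATEMENT.  Write the physical pair identity of `…ProductFormBoxPair` (`boxval_append_cone`) as `A[u++w] = T₁ + T₂ + T₃ + T₄` with
`T₁ + T₂ = 12000·[β𝕄(m₊,m'₋) + β𝕄(m₋,m'₊)]`, `T₃ = 300·β𝕄(m³,m'³)`, `T₄ = (t-terms) − 12·εε'` (`m₊ = colP`, `m₋ = colM`, `m³ = col3`, `ε = E4 = ∏ s_t²`).
Suppose that for every two PHYSICAL words `u, w` of length `≥ 4` the states `v = state(u)`, `v' = state(w)` satisfy
  (PL1) `0 ≤ β𝕄(m₊(v), m₋(v')) + β𝕄(m₋(v), m₊(v'))`, and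
  (PL2) `12·ε(v)ε(v') ≤ 300·β𝕄(m³(v), m³(v')) + ρ·12000·[β𝕄(m₊(v),m₋(v')) + β𝕄(m₋(v),m₊(v'))]` for some fixed `ρ ≤ 1`.
Then `0 ≤ boxval w` for EVERY physical word `w` of EVERY length (`boxval_nonneg_of_pair_laws`): lengths `≤ 7` are `boxval_nonneg_of_length_le_seven`
(`…ProductFormBoxSeven`, gen 71), and a longer word is cut after its 4th letter; `boxval_append_ge` (LEMMA Λ + LEMMA ψ, gen 66/67) gives
`A ≥ (9/64)tt' + (T₁+T₂) + T₃ − 12εε' = (9/64)tt' + [T₃ + ρ(T₁+T₂) − 12εε'] + (1−ρ)(T₁+T₂) ≥ 0`.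
The growth form (PL2') `3z·(5/4)^{|u|+|w|}·ε(v)ε(v') ≤ T₃ + ρ(T₁+T₂)` with `z ≥ 262144/390625 = 12/(3·(5/4)⁸)` implies (PL2) for lengths `≥ 4` (`pairLaw2_of_growth`),
because `ε ≥ 0` along every word (`E4_brunB_nonneg` of `…ProductFormBoxDisc`).

WHY THESE HYPOTHESES (memo §0(3)): on 30 000 adversarial pairs of depth ≥ 3 each, `T₁+T₂ > 0` always, `−T₃/(T₁+T₂) ≤ 0.475`, and `[T₃ + 0.51(T₁+T₂)]/(3(5/4)^k) ≥ 1.048`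
(= 1 exactly at hub × hub): (PL1) and (PL2') with `ρ = 0.51`, `z = 1` hold numerically with room, they are BILINEAR in the two states and free of the `−12εε'` obstruction of
gens 66–70 (the `(5/4)`-character of column 3 pays for `ε`).  They are the remaining target ("LEMMA Q" in its sharp form); this file is the assembly step.  [this work] (gen 72).
-/

namespace Summit.CriticalPhenomena.PercolationContinuityZ3.Theorems.ProductFormABPlus

/-- ★★ THE CUT REDUCTION.  If the two pair laws (PL1), (PL2) hold for all pairs of physical words of length `≥ 4` (some `ρ ≤ 1`), then
`0 ≤ boxval w` for every physical word `w` of every length. [this work] -/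
theorem boxval_nonneg_of_pair_laws (ρ : ℚ) (hρ : ρ ≤ 1)
    (H1 : ∀ u w : List (ℚ × ℚ), (∀ θ ∈ u, 0 ≤ θ.1 + θ.2 ∧ 0 ≤ θ.1 - θ.2) → (∀ θ ∈ w, 0 ≤ θ.1 + θ.2 ∧ 0 ≤ θ.1 - θ.2) →
      4 ≤ u.length → 4 ≤ w.length →
      0 ≤ betaM (colP (brunA u omegaA)) (colM (brunA w omegaA)) + betaM (colM (brunA u omegaA)) (colP (brunA w omegaA)))
    (H2 : ∀ u w : List (ℚ × ℚ), (∀ θ ∈ u, 0 ≤ θ.1 + θ.2 ∧ 0 ≤ θ.1 - θ.2) → (∀ θ ∈ w, 0 ≤ θ.1 + θ.2 ∧ 0 ≤ θ.1 - θ.2) →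
      4 ≤ u.length → 4 ≤ w.length →
      12 * (brunB u omegaB).E4 * (brunB w omegaB).E4 ≤
        300 * betaM (col3 (brunB u omegaB)) (col3 (brunB w omegaB))
        + ρ * (12000 * (betaM (colP (brunA u omegaA)) (colM (brunA w omegaA)) + betaM (colM (brunA u omegaA)) (colP (brunA w omegaA)))))
    (w : List (ℚ × ℚ)) (hw : ∀ θ ∈ w, 0 ≤ θ.1 + θ.2 ∧ 0 ≤ θ.1 - θ.2) : 0 ≤ boxval w := by
  by_cases hlen : w.length ≤ 7
  · exact boxval_nonneg_of_length_le_seven w hlen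
  · -- cut after the 4th letter
    have hsplit : w = w.take 4 ++ w.drop 4 := (List.take_append_drop 4 w).symm
    have hlen8 : 8 ≤ w.length := by omega
    have hu4 : (w.take 4).length = 4 := by
      rw [List.length_take]; omega
    have hv4 : 4 ≤ (w.drop 4).length := by
      rw [List.length_drop]; omega
    have hphys := (physical_append_iff (u := w.take 4) (w := w.drop 4)).mp (hsplit ▸ hw)
    have hu := hphys.1
    have hv := hphys.2
    have hur : ∀ θ ∈ (w.take 4).reverse, 0 ≤ θ.1 + θ.2 ∧ 0 ≤ θ.1 - θ.2 := physical_reverse hu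
    have hune : w.take 4 ≠ [] := by
      intro h; rw [h] at hu4; simp at hu4
    have hvne : w.drop 4 ≠ [] := by
      intro h; rw [h] at hv4; simp at hv4
    have hge := boxval_append_ge (w.take 4) (w.drop 4) hu hv hune hvne
    have hurlen : 4 ≤ (w.take 4).reverse.length := by rw [List.length_reverse]; omega
    have h1 := H1 (w.take 4).reverse (w.drop 4) hur hv hurlen hv4
    have h2 := H2 (w.take 4).reverse (w.drop 4) hur hv hurlen hv4
    have ht := t_brunA_nonneg (w.take 4).reverse hur
    have ht' := t_brunA_nonneg (w.drop 4) hv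
    rw [hsplit]
    set S := betaM (colP (brunA (w.take 4).reverse omegaA)) (colM (brunA (w.drop 4) omegaA))
      + betaM (colM (brunA (w.take 4).reverse omegaA)) (colP (brunA (w.drop 4) omegaA)) with hS
    have hS1 : 0 ≤ (1 - ρ) * (12000 * S) := mul_nonneg (by linarith) (by linarith)
    nlinarith [mul_nonneg ht ht']

/-- The GROWTH form of the second pair law implies (PL2) for lengths `≥ 4`: if `3z·(5/4)^{|u|+|w|}·εε' ≤ T₃ + ρ(T₁+T₂)` with
`z ≥ 262144/390625 = 12/(3·(5/4)⁸)`, then `12εε' ≤ T₃ + ρ(T₁+T₂)` (since `(5/4)^{|u|+|w|} ≥ (5/4)⁸` and `εε' ≥ 0`). [this work] -/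
theorem pairLaw2_of_growth (ρ z : ℚ) (hz : 262144/390625 ≤ z)
    (G : ∀ u w : List (ℚ × ℚ), (∀ θ ∈ u, 0 ≤ θ.1 + θ.2 ∧ 0 ≤ θ.1 - θ.2) → (∀ θ ∈ w, 0 ≤ θ.1 + θ.2 ∧ 0 ≤ θ.1 - θ.2) →
      4 ≤ u.length → 4 ≤ w.length →
      3 * z * (5/4 : ℚ) ^ (u.length + w.length) * ((brunB u omegaB).E4 * (brunB w omegaB).E4) ≤
        300 * betaM (col3 (brunB u omegaB)) (col3 (brunB w omegaB))
        + ρ * (12000 * (betaM (colP (brunA u omegaA)) (colM (brunA w omegaA)) + betaM (colM (brunA u omegaA)) (colP (brunA w omegaA)))))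
    (u w : List (ℚ × ℚ)) (hu : ∀ θ ∈ u, 0 ≤ θ.1 + θ.2 ∧ 0 ≤ θ.1 - θ.2) (hw : ∀ θ ∈ w, 0 ≤ θ.1 + θ.2 ∧ 0 ≤ θ.1 - θ.2)
    (hul : 4 ≤ u.length) (hwl : 4 ≤ w.length) :
    12 * (brunB u omegaB).E4 * (brunB w omegaB).E4 ≤
      300 * betaM (col3 (brunB u omegaB)) (col3 (brunB w omegaB))
      + ρ * (12000 * (betaM (colP (brunA u omegaA)) (colM (brunA w omegaA)) + betaM (colM (brunA u omegaA)) (colP (brunA w omegaA)))) := by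
  have hG := G u w hu hw hul hwl
  have he : 0 ≤ (brunB u omegaB).E4 * (brunB w omegaB).E4 := mul_nonneg (E4_brunB_nonneg u) (E4_brunB_nonneg w)
  -- (5/4)^(|u|+|w|) ≥ (5/4)^8 = 390625/65536
  have hpow8 : (390625/65536 : ℚ) ≤ (5/4 : ℚ) ^ (u.length + w.length) := by
    have h8 : (390625/65536 : ℚ) = (5/4 : ℚ) ^ 8 := by norm_num
    rw [h8]
    exact pow_le_pow_right₀ (by norm_num) (by omega)
  have hz' : 0 ≤ z := by linarith
  have key : 12 * ((brunB u omegaB).E4 * (brunB w omegaB).E4) ≤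
      3 * z * (5/4 : ℚ) ^ (u.length + w.length) * ((brunB u omegaB).E4 * (brunB w omegaB).E4) := by
    have h12 : (12 : ℚ) ≤ 3 * z * (5/4 : ℚ) ^ (u.length + w.length) := by
      have := mul_le_mul (show 3 * (262144/390625 : ℚ) ≤ 3 * z by linarith) hpow8 (by norm_num) (by linarith)
      linarith
    exact mul_le_mul_of_nonneg_right h12 he
  linarith

/-- ★★ The growth form of the reduction: pair laws (PL1) and (PL2') for all pairs of physical words of length `≥ 4` (some `ρ ≤ 1`,
`z ≥ 262144/390625`) imply the box theorem for every physical word of every length. [this work] -/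
theorem boxval_nonneg_of_growth_laws (ρ z : ℚ) (hρ : ρ ≤ 1) (hz : 262144/390625 ≤ z)
    (H1 : ∀ u w : List (ℚ × ℚ), (∀ θ ∈ u, 0 ≤ θ.1 + θ.2 ∧ 0 ≤ θ.1 - θ.2) → (∀ θ ∈ w, 0 ≤ θ.1 + θ.2 ∧ 0 ≤ θ.1 - θ.2) →
      4 ≤ u.length → 4 ≤ w.length →
      0 ≤ betaM (colP (brunA u omegaA)) (colM (brunA w omegaA)) + betaM (colM (brunA u omegaA)) (colP (brunA w omegaA)))
    (G : ∀ u w : List (ℚ × ℚ), (∀ θ ∈ u, 0 ≤ θ.1 + θ.2 ∧ 0 ≤ θ.1 - θ.2) → (∀ θ ∈ w, 0 ≤ θ.1 + θ.2 ∧ 0 ≤ θ.1 - θ.2) →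
      4 ≤ u.length → 4 ≤ w.length →
      3 * z * (5/4 : ℚ) ^ (u.length + w.length) * ((brunB u omegaB).E4 * (brunB w omegaB).E4) ≤
        300 * betaM (col3 (brunB u omegaB)) (col3 (brunB w omegaB))
        + ρ * (12000 * (betaM (colP (brunA u omegaA)) (colM (brunA w omegaA)) + betaM (colM (brunA u omegaA)) (colP (brunA w omegaA)))))
    (w : List (ℚ × ℚ)) (hw : ∀ θ ∈ w, 0 ≤ θ.1 + θ.2 ∧ 0 ≤ θ.1 - θ.2) : 0 ≤ boxval w :=
  boxval_nonneg_of_pair_laws ρ hρ H1 (fun u w hu hw hul hwl => pairLaw2_of_growth ρ z hz G u w hu hw hul hwl) w hw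

/-! ## 2. The corrected reduction: ONE pair law on column 3 against the a-part pairing `kA` (gen 72, second part)

WARNING on §1: hypothesis (PL1) `0 ≤ β𝕄(m₊,m'₋) + β𝕄(m₋,m'₊)` of `boxval_nonneg_of_pair_laws` is NOT a law of the automaton: it fails on the
structured family `u = p^a·(1,1)`, `w = (1,−3/10)·p^b` (e.g. a = 8, b = 4: `12000·[…] = −419` while `A = +681`), where the compensation is the leak term
`(135/112)(tG' + Gt')` of the pair identity — the random census of the memo (§0(3)) missed this family.  The correct a-part quantity is the FULL
a-part pairing `kA(v,v')`, which equals `α_a` of the concatenated word (`kA_pair_eq_alphaA`) and is therefore `≥ 0` for every pair of physical words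
by LEMMA Λ + LEMMA ψ (`kA_pair_nonneg`; `alphaA_brunA_nonneg`).  The remaining target is the single COLUMN-3 LAW
  (PL*) `12·ε(v)ε(v') ≤ 300·β𝕄(m³(v), m³(v')) + ρ·kA(v, v')` (some `ρ ≤ 1`; measured `ρ = 0.51` with the growth form `3z(5/4)^{|u|+|w|}εε'`, `z = 1.05`),
and `boxval_nonneg_of_col3_law` / `boxval_nonneg_of_col3_growth_law` reduce the box theorem for every length to it. -/

/-- The a-part pairing of the two cut states is `α_a` of the concatenated word: `kA(state(ũ), state(w)) = α_a(state(u ++ w))`. [this work] -/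
theorem kA_pair_eq_alphaA (u w : List (ℚ × ℚ)) :
    kA (brunA u.reverse omegaA) (brunA w omegaA) = alphaA (brunA (u ++ w) omegaA) := by
  rw [kA_brunA, List.reverse_reverse, kA_omegaA, brunA_append]

/-- `α_a ≥ 0` on every state reached by a NONEMPTY physical word (LEMMA Λ + LEMMA ψ through `alpha_eq_cone`:
`α_a = (15/8)t + (45/14)G + 15G_ψ`). [this work] -/
theorem alphaA_brunA_nonneg (w : List (ℚ × ℚ)) (hw : ∀ θ ∈ w, 0 ≤ θ.1 + θ.2 ∧ 0 ≤ θ.1 - θ.2) (hne : w ≠ []) :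
    0 ≤ alphaA (brunA w omegaA) := by
  have h := alpha_eq_cone (brunA w omegaA) omegaB
  have hB : alphaB omegaB = -9 := by simp [alphaB, omegaB]; norm_num
  have hG := zOfG_nonneg w hw hne
  have hP := Gpsi_nonneg w hw
  have ht := t_brunA_nonneg w hw
  have hE5 : omegaB.E5 = -(1/10) := rfl
  have hE4 : omegaB.E4 = 1 := rfl
  rw [hB, hE5, hE4] at h
  linarith

/-- The a-part pairing of two physical cut states is nonnegative whenever one of the words is nonempty. [this work] -/
theorem kA_pair_nonneg (u w : List (ℚ × ℚ)) (hu : ∀ θ ∈ u, 0 ≤ θ.1 + θ.2 ∧ 0 ≤ θ.1 - θ.2)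
    (hw : ∀ θ ∈ w, 0 ≤ θ.1 + θ.2 ∧ 0 ≤ θ.1 - θ.2) (hne : w ≠ []) :
    0 ≤ kA (brunA u.reverse omegaA) (brunA w omegaA) := by
  rw [kA_pair_eq_alphaA]
  refine alphaA_brunA_nonneg (u ++ w) ?_ (by simp [hne])
  exact (physical_append_iff).mpr ⟨hu, hw⟩

/-- ★★ THE CORRECTED CUT REDUCTION.  If for some `ρ ≤ 1` the column-3 law
(PL*) `12·ε(ũ)ε(w) ≤ 300·β𝕄(m³(ũ), m³(w)) + ρ·kA(ũ, w)` holds for the cut states `ũ = state(reverse u)`, `w = state(w)` of all physical words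
`u, w` of length `≥ 4`, then `0 ≤ boxval w` for every physical word of every length. [this work] -/
theorem boxval_nonneg_of_col3_law (ρ : ℚ) (hρ : ρ ≤ 1)
    (H : ∀ u w : List (ℚ × ℚ), (∀ θ ∈ u, 0 ≤ θ.1 + θ.2 ∧ 0 ≤ θ.1 - θ.2) → (∀ θ ∈ w, 0 ≤ θ.1 + θ.2 ∧ 0 ≤ θ.1 - θ.2) →
      4 ≤ u.length → 4 ≤ w.length →
      12 * (brunB u.reverse omegaB).E4 * (brunB w omegaB).E4 ≤
        300 * betaM (col3 (brunB u.reverse omegaB)) (col3 (brunB w omegaB)) + ρ * kA (brunA u.reverse omegaA) (brunA w omegaA))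
    (w : List (ℚ × ℚ)) (hw : ∀ θ ∈ w, 0 ≤ θ.1 + θ.2 ∧ 0 ≤ θ.1 - θ.2) : 0 ≤ boxval w := by
  by_cases hlen : w.length ≤ 7
  · exact boxval_nonneg_of_length_le_seven w hlen
  · have hsplit : w = w.take 4 ++ w.drop 4 := (List.take_append_drop 4 w).symm
    have hu4 : (w.take 4).length = 4 := by rw [List.length_take]; omega
    have hv4 : 4 ≤ (w.drop 4).length := by rw [List.length_drop]; omega
    have hphys := (physical_append_iff (u := w.take 4) (w := w.drop 4)).mp (hsplit ▸ hw)
    have hvne : w.drop 4 ≠ [] := by intro h; rw [h] at hv4; simp at hv4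
    have h := H (w.take 4) (w.drop 4) hphys.1 hphys.2 (by omega) hv4
    have hk := kA_pair_nonneg (w.take 4) (w.drop 4) hphys.1 hphys.2 hvne
    rw [hsplit, boxval_append, kB_coords]
    nlinarith [mul_nonneg (show (0:ℚ) ≤ 1 - ρ by linarith) hk]

/-- ★★ Growth form: if `3z·(5/4)^{|u|+|w|}·ε(ũ)ε(w) ≤ 300·β𝕄(m³(ũ), m³(w)) + ρ·kA(ũ, w)` for all pairs of physical words of length `≥ 4`
(some `ρ ≤ 1`, `z ≥ 262144/390625 = 12/(3·(5/4)⁸)`), then `0 ≤ boxval w` for every physical word.  Measured (memo §0(3)): the law holds with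
`ρ = 51/100`, `z = 1` on 30 000 adversarial pairs of depth ≥ 3 and on the structured families that break (PL1). [this work] -/
theorem boxval_nonneg_of_col3_growth_law (ρ z : ℚ) (hρ : ρ ≤ 1) (hz : 262144/390625 ≤ z)
    (G : ∀ u w : List (ℚ × ℚ), (∀ θ ∈ u, 0 ≤ θ.1 + θ.2 ∧ 0 ≤ θ.1 - θ.2) → (∀ θ ∈ w, 0 ≤ θ.1 + θ.2 ∧ 0 ≤ θ.1 - θ.2) →
      4 ≤ u.length → 4 ≤ w.length →
      3 * z * (5/4 : ℚ) ^ (u.length + w.length) * ((brunB u.reverse omegaB).E4 * (brunB w omegaB).E4) ≤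
        300 * betaM (col3 (brunB u.reverse omegaB)) (col3 (brunB w omegaB)) + ρ * kA (brunA u.reverse omegaA) (brunA w omegaA))
    (w : List (ℚ × ℚ)) (hw : ∀ θ ∈ w, 0 ≤ θ.1 + θ.2 ∧ 0 ≤ θ.1 - θ.2) : 0 ≤ boxval w := by
  refine boxval_nonneg_of_col3_law ρ hρ ?_ w hw
  intro u v hu hv hul hvl
  have hG := G u v hu hv hul hvl
  have he : 0 ≤ (brunB u.reverse omegaB).E4 * (brunB v omegaB).E4 := mul_nonneg (E4_brunB_nonneg _) (E4_brunB_nonneg _)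
  have hpow8 : (390625/65536 : ℚ) ≤ (5/4 : ℚ) ^ (u.length + v.length) := by
    have h8 : (390625/65536 : ℚ) = (5/4 : ℚ) ^ 8 := by norm_num
    rw [h8]
    exact pow_le_pow_right₀ (by norm_num) (by omega)
  have h12 : (12 : ℚ) ≤ 3 * z * (5/4 : ℚ) ^ (u.length + v.length) := by
    have := mul_le_mul (show 3 * (262144/390625 : ℚ) ≤ 3 * z by linarith) hpow8 (by norm_num) (by linarith)
    linarith
  have key := mul_le_mul_of_nonneg_right h12 he
  linarith


/-! ## 3. The one-sided form: CLAIM F* (gen 72, third part)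

Since `300·β𝕄(m³(ũ),m³(w)) = −30·ζ(u++w)` and `kA(ũ,w) = α_a(u++w)` are cut-independent, the pair law (PL*) is the same as a ONE-STATE law on words of
length `≥ 8`: CLAIM F*: `ρ·α_a(v) − 30·ζ(v) ≥ 3z·(5/4)^{|w|}·ε(v)` (`v` = state of `w`, `ζ = col3.z = E5`), for some `ρ ≤ 1`, `z ≥ 262144/390625`.
Measured (kit j345675, L-BFGS adversarial, k = 8..14): `inf_w (0.55·α_a − 30ζ)/(5/4)^k = 3.23, 3.10, 3.04, 3.02 → 3` (hub value), so `ρ = 11/20`, `z = 19/20` hold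
with room.  `boxval_nonneg_of_claimF` reduces the box theorem for every length to CLAIM F* on lengths `≥ 8`. -/

/-- ★★ ONE-SIDED REDUCTION (CLAIM F*).  If for some `ρ ≤ 1` and `z ≥ 262144/390625` every physical word `w` of length `≥ 8` satisfies
`3z·(5/4)^{|w|}·ε ≤ ρ·α_a − 30·ζ` on its state, then `0 ≤ boxval w` for every physical word of every length. [this work] -/
theorem boxval_nonneg_of_claimF (ρ z : ℚ) (hρ : ρ ≤ 1) (hz : 262144/390625 ≤ z)
    (F : ∀ w : List (ℚ × ℚ), (∀ θ ∈ w, 0 ≤ θ.1 + θ.2 ∧ 0 ≤ θ.1 - θ.2) → 8 ≤ w.length →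
      3 * z * (5/4 : ℚ) ^ w.length * (brunB w omegaB).E4 ≤ ρ * alphaA (brunA w omegaA) - 30 * (brunB w omegaB).E5)
    (w : List (ℚ × ℚ)) (hw : ∀ θ ∈ w, 0 ≤ θ.1 + θ.2 ∧ 0 ≤ θ.1 - θ.2) : 0 ≤ boxval w := by
  by_cases hlen : w.length ≤ 7
  · exact boxval_nonneg_of_length_le_seven w hlen
  · have h8 : 8 ≤ w.length := by omega
    have hF := F w hw h8
    have hne : w ≠ [] := by intro h; rw [h] at h8; simp at h8
    have hA := alphaA_brunA_nonneg w hw hne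
    have hE := E4_brunB_nonneg w
    have hpow8 : (390625/65536 : ℚ) ≤ (5/4 : ℚ) ^ w.length := by
      have e8 : (390625/65536 : ℚ) = (5/4 : ℚ) ^ 8 := by norm_num
      rw [e8]; exact pow_le_pow_right₀ (by norm_num) h8
    have h12 : (12 : ℚ) ≤ 3 * z * (5/4 : ℚ) ^ w.length := by
      have := mul_le_mul (show 3 * (262144/390625 : ℚ) ≤ 3 * z by linarith) hpow8 (by norm_num) (by linarith)
      linarith
    have key := mul_le_mul_of_nonneg_right h12 hE
    have hb : boxval w = alphaA (brunA w omegaA) + (-30 * (brunB w omegaB).E5 - 12 * (brunB w omegaB).E4) := by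
      simp only [boxval, alphaB]
    rw [hb]
    nlinarith [mul_nonneg (show (0:ℚ) ≤ 1 - ρ by linarith) hA]

end Summit.CriticalPhenomena.PercolationContinuityZ3.Theorems.ProductFormABPlus
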